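import Mathlib
import Summits.BirchSwinnertonDyer.BirchSwinnertonDyer.Theorems.ManinLocalTwoThreeOddDegreeForcesQuarterSymbol
import Summits.BirchSwinnertonDyer.BirchSwinnertonDyer.Theorems.ManinLocalTwoThreeHalfTranslationFixedCusp
import HarnessLib

/-!
# The quarter symbol is a HALF-PERIOD at every level `4M`, `M` odd; at `N = 4p` with odd degree `φ(1/4)` has exact order `2`

Summit `BirchSwinnertonDyer`, sub-problem `BirchSwinnertonDyer`, route `ManinLocalTwoThree`; width seat `bsd-line-manin23-p2`
(gen 9), `--supports` the crux C2 `ManinOddAtFour` (stmt-BirchSwinnertonDyer-22967).  Cell `bsd-f2-manin`, an lens (E-an-80 /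
THEOREM A package, MEMO-an §60): the tree's `two_mul_quarterSymbol_mem_periodLattice_twenty` (`N = 20`) generalised with the
matrix its docstring names, `γ_M = (1 − 6M, (3M+1)/2; −8M, 2M+1) ∈ Γ₀(4M)` (`γ_M(1/4) = 3/4 = 1/4 + 1/2`): for every `f` on
`Γ₀(4M)`, `M` odd, with vanishing even coefficients, `2{∞, 1/4}_f ∈ Λ_f`; so `φ_D([1/4]) ∈ E[2]` for every datum, and with the
seat's `two_dvd_deg_of_quarterSymbol_mem` (p658678): at `N = 4p`, `p` odd, an ODD-degree parametrisation sends the cusp `1/4`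
to a point of EXACT order `2` of `E(ℂ)`.

PROVED here (no `sorry`): **`two_mul_quarterSymbol_mem_periodLattice`** (`4M`, `M` odd), `two_smul_cuspImage_quarter_eq_zero`,
**`addOrderOf_cuspImage_quarter_eq_two_of_odd_deg`** (`N = 4p`, lattice-optimal datum).  BSD is not proved by this; Manin's conjecture is not proved
by this.
-/

set_option autoImplicit false
set_option linter.dupNamespace false

noncomputable section

open scoped MatrixGroups ModularForm
open CongruenceSubgroup
open Literature.NumberTheory.EllipticCurves Literature.NumberTheory.EllipticCurves.ModularForms
open Summit.BirchSwinnertonDyer.Rank1Residual.ManinAdditive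

namespace Summit.BirchSwinnertonDyer.BirchSwinnertonDyer.Theorems.ManinLocalTwoThree

/-- **`2{∞, 1/4}_f ∈ Λ_f` at every level `4M`, `M` odd**, for every `f` with vanishing even coefficients: the cusp `1/4` is
`t`-fixed, witnessed by `γ_M = (1 − 6M, (3M+1)/2; −8M, 2M+1)`. -/
theorem two_mul_quarterSymbol_mem_periodLattice {M : ℕ} [NeZero (4 * M)] (hM : Odd M) (f : CuspForm (Gamma0 (4 * M)) 2)
    (heven : ∀ n : ℕ, 2 ∣ n → cuspCoeff f n = 0) :
    (2 : ℂ) * modularSymbol f (1 / 4 : ℚ) ∈ periodLattice f := by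
  obtain ⟨m', hm'⟩ := hM
  have hMZ : (M : ℤ) = 2 * m' + 1 := by exact_mod_cast hm'
  let γM : SL(2, ℤ) := ⟨!![1 - 6 * (M : ℤ), 3 * m' + 2; -8 * (M : ℤ), 2 * M + 1], by
    rw [Matrix.det_fin_two_of, hMZ]; ring⟩
  have hγM : γM ∈ Gamma0 (4 * M) := by
    rw [Gamma0_mem]
    show (((-8 * (M : ℤ)) : ℤ) : ZMod (4 * M)) = 0
    rw [ZMod.intCast_zmod_eq_zero_iff_dvd]
    exact ⟨-2, by push_cast; ring⟩
  have h00 : (((⟨γM, hγM⟩ : Gamma0 (4 * M)) : SL(2, ℤ)) 0 0 : ℤ) = 1 - 6 * (M : ℤ) := rfl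
  have h01 : (((⟨γM, hγM⟩ : Gamma0 (4 * M)) : SL(2, ℤ)) 0 1 : ℤ) = 3 * m' + 2 := rfl
  have h10 : (((⟨γM, hγM⟩ : Gamma0 (4 * M)) : SL(2, ℤ)) 1 0 : ℤ) = -8 * (M : ℤ) := rfl
  have h11 : (((⟨γM, hγM⟩ : Gamma0 (4 * M)) : SL(2, ℤ)) 1 1 : ℤ) = 2 * M + 1 := rfl
  have hMQ : (M : ℚ) = 2 * m' + 1 := by exact_mod_cast hm'
  refine two_mul_modularSymbol_mem_periodLattice_of_halfFixed f (dvd_mul_right 4 M) heven ⟨γM, hγM⟩ (1 / 4) ?_ ?_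
  · rw [h10, h11]; push_cast
    have : -8 * (M : ℚ) * (1 / 4) + (2 * (M : ℚ) + 1) = 1 := by ring
    rw [this]; exact one_ne_zero
  · rw [h00, h01, h10, h11]; push_cast; rw [hMQ]
    have hden : -8 * (2 * (m' : ℚ) + 1) * (1 / 4) + (2 * (2 * (m' : ℚ) + 1) + 1) = 1 := by ring
    rw [hden, div_one]; ring

/-- **`2·φ_D([1/4]) = O`** for every `X₀(4M)`-datum, `M` odd (the newform's even coefficients vanish at `4 ∣ N`). -/
theorem two_smul_cuspImage_quarter_eq_zero {M : ℕ} [NeZero (4 * M)] (hM : Odd M) {W : WeierstrassCurve ℚ} [W.IsElliptic]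
    (D : ModularParametrizationData W (4 * M)) :
    2 • D.uniformize ((D.c : ℂ) * modularSymbol D.f (1 / 4 : ℚ)) = 0 := by
  have h := two_mul_quarterSymbol_mem_periodLattice hM D.f fun n hn =>
    Literature.NumberTheory.Automorphic.IsNewform0.cuspCoeff_eq_zero_of_two_dvd D.isNewformOf.1 (dvd_mul_right 4 M) hn
  rw [← map_nsmul, nsmul_eq_mul, Nat.cast_ofNat, show (2 : ℂ) * ((D.c : ℂ) * modularSymbol D.f (1 / 4 : ℚ)) =
    (D.c : ℂ) * (2 * modularSymbol D.f (1 / 4 : ℚ)) by ring]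
  exact (D.uniformize_eq_zero_iff _).mpr (D.smul_periodLattice_le _ h)

/-- **At `N = 4p` (`p` odd, `p ≠ 1`) an odd-degree parametrisation sends the cusp `1/4` to a point of EXACT order `2` of `E(ℂ)`.** -/
theorem addOrderOf_cuspImage_quarter_eq_two_of_odd_deg {p : ℕ} [NeZero (4 * p)] (hp : Odd p) (hp1 : p ≠ 1)
    {W : WeierstrassCurve ℚ} [W.IsElliptic] (D : ModularParametrizationData W (4 * p))
    (hopt : ∀ z ∈ D.L.lattice, ∃ w ∈ periodLattice D.f, z = D.c * w) (hc : D.c ≠ 0) (hodd : Odd D.deg) :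
    addOrderOf (D.uniformize ((D.c : ℂ) * modularSymbol D.f (1 / 4 : ℚ))) = 2 := by
  haveI : Fact (Nat.Prime 2) := ⟨Nat.prime_two⟩
  refine addOrderOf_eq_prime ?_ ?_
  · exact two_smul_cuspImage_quarter_eq_zero hp D
  · intro h0
    have hmem : modularSymbol D.f (1 / 4 : ℚ) ∈ periodLattice D.f := by
      obtain ⟨w, hw, hcw⟩ := hopt _ ((D.uniformize_eq_zero_iff _).mp h0)
      have hc' : (D.c : ℂ) ≠ 0 := by exact_mod_cast hc
      rwa [mul_left_cancel₀ hc' hcw]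
    exact quarterSymbol_not_mem_of_odd_deg hp hp1 D hodd hmem

end Summit.BirchSwinnertonDyer.BirchSwinnertonDyer.Theorems.ManinLocalTwoThree

end
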